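import Summits.CriticalPhenomena.CardyFormulaZ2.Theorems.CardyComplexConeEdgePrecompactUFRSStrandsHpArmsPureSectors
import Summits.CriticalPhenomena.CardyFormulaZ2.Theorems.CardyComplexConeEdgePrecompactUFRSMixedPieces

/-!
# Sectors of corner-disjoint strands of SEVERAL completions relative to an exterior set
(line `qkz-strip-boundary-arm` of crux `CardyComplexCone.EdgePrecompact`, stmt-CriticalPhenomena-11387;
input of the registered open sub-goal `ufrs_rect_threeStrands_dichotomy`, the dichotomy behind the
flat three-strand decay HT for MIXED tags; worker W-HT of lead c5, wave 4)

`strands_sectorsZ` (`…UFRSStrandsHpArmsPureSectors.lean`, Aizenman–Burchard sectors relative to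
an exterior set) treats `k` corner-disjoint orbit stretches of ONE configuration; the strands of
`ufrsStrands E w z k s S` come from TWO (`E.bcBondConfig ω`, `(shiftData E w).bcBondConfig ω`).
The single configuration entered only through (i) the disjointness of pieces of different
stretches — now `pieces_meet_two_HT4` (`…UFRSMixedPieces.lean`) — and (ii) the obstacle
hypotheses of `chain_in_component` (open edges / closed dual steps miss ALL pieces), which with
several configurations hold only PER STEP of the chain (`followedEdge_meets_piece_HT4`,
`crossSeg_meets_piece_HT4`: a foreign piece on the followed edge or on the dual step passes
through one of the two corners of the step). Contents: `chain_in_component_steps_HT4`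
(per-step obstacle hypotheses) and `strands_sectorsZ_mixed_HT4` / `ufrs_strandsSectorsZ_mixed`
(registered anchor) for `β : Fin k → BondConfig (Site 2)`; the final probe clause of
`strands_sectorsZ` is dropped (false for several configurations: an edge closed for one strand
may be bounced on by another).

References: M. Aizenman, A. Burchard, Duke Math. J. 99 (1999), App. A, Lemma A.5;
S. Smirnov, C. R. Acad. Sci. Paris 333 (2001), §2.
-/

namespace Summit.CriticalPhenomena.CardyFormulaZ2.Cruxes.EdgePrecompact.QkzStripBoundaryArm

open MeasureTheory Filter Set Metric Complex
open scoped Topology BigOperators Pointwise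
open Literature.Probability.LatticeModels Literature.Probability.Percolation
open Literature.Probability.RandomPlanarGeometry (DobrushinDomain)
open Summit.CriticalPhenomena.CardyFormulaZ2.Theses.CardyComplexCone
open Literature.Topology.PlaneTopology

noncomputable section

/-! ## Per-step obstacle lemmas with the sharp index range -/

/-- `followedEdge_not_mem_pieces_HT4` with the sharp piece range `jj ≤ 2 j₂` (last dart piece included). -/
theorem followedEdge_not_mem_pieces_HT4' {β₁ β₂ : BondConfig (Site 2)} (c₁ c₂ : Site 2 × Fin 4) {t j₂ : ℕ}
    (hopen : cTgt (cornerOrbit β₁ c₁ t) ∈ β₁)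
    (hdis : ∀ s u, (s = t ∨ s = t + 1) → u ≤ j₂ → cornerOrbit β₁ c₁ s ≠ cornerOrbit β₂ c₂ u)
    {jj : ℕ} (hjj : jj ≤ 2 * j₂) {z : ℂ}
    (hz : z ∈ segment ℝ (pieceVert β₂ c₂ jj) (pieceVert β₂ c₂ (jj + 1))) :
    z ∉ segment ℝ (Site.toComplex (cornerOrbit β₁ c₁ t).1)
      (Site.toComplex ((cornerOrbit β₁ c₁ t).1 + cornerUnit ((cornerOrbit β₁ c₁ t).2 + 1))) := by
  intro hz'
  obtain ⟨u, hu, h⟩ := followedEdge_meets_piece_HT4 hopen c₂ hz hz'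
  have hu' : u ≤ j₂ := by rcases hu with rfl | rfl <;> omega
  rcases h with h | h
  · exact hdis t u (Or.inl rfl) hu' h.symm
  · exact hdis (t + 1) u (Or.inr rfl) hu' h.symm

/-- `crossSeg_not_mem_pieces_HT4` with the sharp piece range `jj ≤ 2 j₂`. -/
theorem crossSeg_not_mem_pieces_HT4' {β₁ β₂ : BondConfig (Site 2)} (c₁ c₂ : Site 2 × Fin 4) {t j₂ : ℕ}
    (hclosed : cTgt (cornerOrbit β₁ c₁ t) ∉ β₁)
    (hdis : ∀ s u, (s = t ∨ s = t + 1) → u ≤ j₂ → cornerOrbit β₁ c₁ s ≠ cornerOrbit β₂ c₂ u)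
    {jj : ℕ} (hjj : jj ≤ 2 * j₂) {z : ℂ}
    (hz : z ∈ segment ℝ (pieceVert β₂ c₂ jj) (pieceVert β₂ c₂ (jj + 1))) :
    z ∉ segment ℝ (faceCenter (cFace (cornerOrbit β₁ c₁ t))) (faceCenter (faceAt (cornerOrbit β₁ c₁ t).1 ((cornerOrbit β₁ c₁ t).2 + 1))) := by
  intro hz'
  obtain ⟨u, hu, h⟩ := crossSeg_meets_piece_HT4 hclosed c₂ hz hz'
  have hu' : u ≤ j₂ := by rcases hu with rfl | rfl <;> omega
  rcases h with h | h
  · exact hdis t u (Or.inl rfl) hu' h.symm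
  · exact hdis (t + 1) u (Or.inr rfl) hu' h.symm

/-! ## The chain in one component, per-step obstacle hypotheses -/

/-- **The chain of a strand keeps its left vertices in one component and its right faces in one
component** of the annulus minus `K` — `chain_in_component` with per-step obstacle hypotheses
(the followed open edge, resp. the crossed dual step, of each step of the chain misses `K`). -/
theorem chain_in_component_steps_HT4 (β : BondConfig (Site 2)) (q : Site 2 × Fin 4) (z : ℂ) {r R : ℝ} (K : Set ℂ)
    (hKv : ∀ u : Site 2, Site.toComplex u ∉ K) (hKc : ∀ g : Site 2, faceCenter g ∉ K)
    {i' j' : ℕ}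
    (hKe : ∀ u, i' ≤ u → u + 1 ≤ j' → cTgt (cornerOrbit β q u) ∈ β →
      ∀ P ∈ segment ℝ (Site.toComplex (cornerOrbit β q u).1)
        (Site.toComplex ((cornerOrbit β q u).1 + cornerUnit ((cornerOrbit β q u).2 + 1))), P ∉ K)
    (hKx : ∀ u, i' ≤ u → u + 1 ≤ j' → cTgt (cornerOrbit β q u) ∉ β →
      ∀ P ∈ segment ℝ (faceCenter (cFace (cornerOrbit β q u)))
        (faceCenter (faceAt (cornerOrbit β q u).1 ((cornerOrbit β q u).2 + 1))), P ∉ K)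
    (hchain : ∀ t, i' ≤ t → t ≤ j' →
      r + 1 < dist (Site.toComplex (cornerOrbit β q t).1) z ∧ dist (Site.toComplex (cornerOrbit β q t).1) z < R - 1 ∧
      r + 1 < dist (faceCenter (cFace (cornerOrbit β q t))) z ∧ dist (faceCenter (cFace (cornerOrbit β q t))) z < R - 1)
    {s t : ℕ} (hs : i' ≤ s) (hs' : s ≤ j') (ht : i' ≤ t) (ht' : t ≤ j') :
    Site.toComplex (cornerOrbit β q t).1 ∈ connectedComponentIn ({w | r + 1 / 2 < dist w z ∧ dist w z < R - 1 / 2} \ K)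
        (Site.toComplex (cornerOrbit β q s).1) ∧
      faceCenter (cFace (cornerOrbit β q t)) ∈ connectedComponentIn ({w | r + 1 / 2 < dist w z ∧ dist w z < R - 1 / 2} \ K)
        (faceCenter (cFace (cornerOrbit β q s))) := by
  set X : Set ℂ := {w | r + 1 / 2 < dist w z ∧ dist w z < R - 1 / 2} \ K with hX
  have hsegX : ∀ {A B : ℂ}, r + 1 < dist A z ∧ dist A z < R - 1 → r + 1 < dist B z ∧ dist B z < R - 1 →
      dist A B ≤ 1 → (∀ P ∈ segment ℝ A B, P ∉ K) →
      connectedComponentIn X A = connectedComponentIn X B := by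
    intro A B hA hB hAB hK
    refine connectedComponentIn_eq ((convex_segment _ _).isPreconnected.subset_connectedComponentIn
      (left_mem_segment _ _ _) (fun P hP => ?_) (right_mem_segment _ _ _))
    obtain ⟨h1, h2⟩ := segment_annulus hA hB hAB P hP
    exact ⟨⟨by linarith, by linarith⟩, hK P hP⟩
  have hstep : ∀ u, i' ≤ u → u + 1 ≤ j' →
      connectedComponentIn X (Site.toComplex (cornerOrbit β q u).1) = connectedComponentIn X (Site.toComplex (cornerOrbit β q (u + 1)).1) ∧
      connectedComponentIn X (faceCenter (cFace (cornerOrbit β q u))) = connectedComponentIn X (faceCenter (cFace (cornerOrbit β q (u + 1)))) := by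
    intro u h1 h2
    have hc1 := hchain u h1 (by omega)
    have hc2 := hchain (u + 1) (by omega) h2
    have hsucc : cornerOrbit β q (u + 1) = nextCorner β (cornerOrbit β q u) := rfl
    by_cases hopen : cTgt (cornerOrbit β q u) ∈ β
    · constructor
      · refine hsegX ⟨hc1.1, hc1.2.1⟩ ⟨hc2.1, hc2.2.1⟩ (by rw [dist_comm]; exact dist_vertex_succ_le β q u) ?_
        rw [hsucc, nextCorner_of_mem hopen]
        exact hKe u h1 h2 hopen
      · have hf : cFace (cornerOrbit β q (u + 1)) = cFace (cornerOrbit β q u) := by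
          rw [hsucc]; exact cFace_nextCorner_of_mem hopen
        rw [hf]
    · constructor
      · rw [hsucc, nextCorner_of_not_mem hopen]
      · refine hsegX ⟨hc1.2.2.1, hc1.2.2.2⟩ ⟨hc2.2.2.1, hc2.2.2.2⟩ (by rw [dist_comm]; exact dist_faceCenter_succ_le β q u) ?_
        have hf : cFace (cornerOrbit β q (u + 1)) = faceAt (cornerOrbit β q u).1 ((cornerOrbit β q u).2 + 1) := by
          rw [hsucc]; exact cFace_nextCorner_of_not_mem hopen
        rw [hf]
        exact hKx u h1 h2 hopen
  have key : ∀ d, i' + d ≤ j' →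
      connectedComponentIn X (Site.toComplex (cornerOrbit β q (i' + d)).1) = connectedComponentIn X (Site.toComplex (cornerOrbit β q i').1) ∧
      connectedComponentIn X (faceCenter (cFace (cornerOrbit β q (i' + d)))) = connectedComponentIn X (faceCenter (cFace (cornerOrbit β q i'))) := by
    intro d
    induction d with
    | zero => intro; exact ⟨rfl, rfl⟩
    | succ d ih =>
      intro hd
      obtain ⟨e1, e2⟩ := ih (by omega)
      obtain ⟨f1, f2⟩ := hstep (i' + d) (by omega) (by omega)
      rw [← add_assoc, ← f1, ← f2]
      exact ⟨e1, e2⟩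
  obtain ⟨es1, es2⟩ := key (s - i') (by omega)
  obtain ⟨et1, et2⟩ := key (t - i') (by omega)
  rw [show i' + (s - i') = s by omega] at es1 es2
  rw [show i' + (t - i') = t by omega] at et1 et2
  have hct := hchain t ht ht'
  constructor
  · show _ ∈ connectedComponentIn X _
    rw [es1, ← et1]
    exact mem_connectedComponentIn ⟨⟨by linarith [hct.1], by linarith [hct.2.1]⟩, hKv _⟩
  · show _ ∈ connectedComponentIn X _
    rw [es2, ← et2]
    exact mem_connectedComponentIn ⟨⟨by linarith [hct.2.2.1], by linarith [hct.2.2.2]⟩, hKc _⟩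

/-! ## Sectors for several configurations -/

/-- **Sectors of corner-disjoint strands of several configurations relative to an exterior set**
(mesh `1`). For `k` orbit stretches, the `a`-th one of `nextCorner (β a)`, pairwise sharing no
corner, each joining the `r`-ball of `z` to
distance `≥ R ≥ r + 16`, and a preconnected set `Z` inside the open annulus `(r + 1/2, R - 1/2)`
missing every dart piece and every connector of the stretches: left sectors `cL`, right sectors
`cR` (pairwise equal or disjoint, no three strands with the same sector, at most one of each kind
meeting `Z`), left walks (support vertices in `cL`, open target edges) and right walks (support
face centres in `cR`, closed crossed target edges) of sub-chains of the stretches at distance in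
`(r + 1, R - 1)`, with one end within `r + 4` and the other beyond `R - 4`. (The probe clause of `strands_sectorsZ`
— arbitrary closed dual steps from right-walk faces stay in the sector — is dropped: with several
configurations it fails, an edge closed for one strand may be bounced on by another.) -/
theorem strands_sectorsZ_mixed_HT4 {k : ℕ} (β : Fin k → BondConfig (Site 2)) (z : ℂ) (c : Fin k → Site 2 × Fin 4)
    (i j : Fin k → ℕ) {r R : ℝ} (hr : 0 ≤ r) (hrR : r + 16 ≤ R) (hij : ∀ a, i a ≤ j a)
    (hdir : ∀ a, (dist (Site.toComplex (cornerOrbit (β a) (c a) (i a)).1) z ≤ r ∧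
        R ≤ dist (Site.toComplex (cornerOrbit (β a) (c a) (j a)).1) z) ∨
      (R ≤ dist (Site.toComplex (cornerOrbit (β a) (c a) (i a)).1) z ∧
        dist (Site.toComplex (cornerOrbit (β a) (c a) (j a)).1) z ≤ r))
    (hdis : ∀ a b, a ≠ b → ∀ s t, i a ≤ s → s ≤ j a → i b ≤ t → t ≤ j b →
      cornerOrbit (β a) (c a) s ≠ cornerOrbit (β b) (c b) t)
    (Z : Set ℂ) (hZU : ∀ w ∈ Z, r + 1 / 2 < dist w z ∧ dist w z < R - 1 / 2) (hZc : IsPreconnected Z)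
    (hZK : ∀ a t, i a ≤ t → t ≤ j a →
      (∀ w ∈ segment ℝ (sPt (cornerOrbit (β a) (c a) t)) (tPt (cornerOrbit (β a) (c a) t)), w ∉ Z) ∧
      (t < j a → ∀ w ∈ segment ℝ (tPt (cornerOrbit (β a) (c a) t)) (sPt (cornerOrbit (β a) (c a) (t + 1))), w ∉ Z)) :
    ∃ (cL cR : Fin k → Set ℂ) (xl yl xr yr : Fin k → Site 2) (WL : ∀ s, (zdGraph 2).Walk (xl s) (yl s))
      (WR : ∀ s, (zdGraph 2).Walk (xr s) (yr s)),
      (∀ s₁ s₂ (P : ℂ), P ∈ cL s₁ → P ∈ cL s₂ → cL s₁ = cL s₂) ∧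
      (∀ s₁ s₂ (P : ℂ), P ∈ cR s₁ → P ∈ cR s₂ → cR s₁ = cR s₂) ∧
      (∀ a₁ a₂ a₃ : Fin k, a₁ ≠ a₂ → a₂ ≠ a₃ → a₃ ≠ a₁ → cL a₁ = cL a₂ → cL a₂ = cL a₃ → False) ∧
      (∀ a₁ a₂ a₃ : Fin k, a₁ ≠ a₂ → a₂ ≠ a₃ → a₃ ≠ a₁ → cR a₁ = cR a₂ → cR a₂ = cR a₃ → False) ∧
      (∀ s₁ s₂, (cL s₁ ∩ Z).Nonempty → (cL s₂ ∩ Z).Nonempty → cL s₁ = cL s₂) ∧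
      (∀ s₁ s₂, (cR s₁ ∩ Z).Nonempty → (cR s₂ ∩ Z).Nonempty → cR s₁ = cR s₂) ∧
      (∀ s, ∀ w ∈ cL s ∪ cR s, r + 1 / 2 < dist w z ∧ dist w z < R - 1 / 2) ∧
      (∀ s, ∀ u ∈ (WL s).support, Site.toComplex u ∈ cL s ∧ ∃ t, i s ≤ t ∧ t ≤ j s ∧ u = (cornerOrbit (β s) (c s) t).1 ∧
        r + 1 < dist (Site.toComplex u) z ∧ dist (Site.toComplex u) z < R - 1) ∧
      (∀ s, ∀ e ∈ (WL s).edges, ∃ t, i s ≤ t ∧ t < j s ∧ e = cTgt (cornerOrbit (β s) (c s) t) ∧ cTgt (cornerOrbit (β s) (c s) t) ∈ β s ∧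
        r + 1 < dist (Site.toComplex (cornerOrbit (β s) (c s) t).1) z ∧ dist (Site.toComplex (cornerOrbit (β s) (c s) t).1) z < R - 1) ∧
      (∀ s, (dist (Site.toComplex (xl s)) z ≤ r + 4 ∧ R - 4 ≤ dist (Site.toComplex (yl s)) z) ∨
        (dist (Site.toComplex (yl s)) z ≤ r + 4 ∧ R - 4 ≤ dist (Site.toComplex (xl s)) z)) ∧
      (∀ s, ∀ g ∈ (WR s).support, faceCenter g ∈ cR s ∧ ∃ t, i s ≤ t ∧ t ≤ j s ∧ g = cFace (cornerOrbit (β s) (c s) t) ∧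
        r + 1 < dist (faceCenter g) z ∧ dist (faceCenter g) z < R - 1) ∧
      (∀ s, ∀ d ∈ (WR s).darts, ∃ t, i s ≤ t ∧ t < j s ∧ sepEdge d.fst d.snd = cTgt (cornerOrbit (β s) (c s) t) ∧
        cTgt (cornerOrbit (β s) (c s) t) ∉ β s ∧
        r + 1 < dist (Site.toComplex (cornerOrbit (β s) (c s) t).1) z ∧ dist (Site.toComplex (cornerOrbit (β s) (c s) t).1) z < R - 1) ∧
      (∀ s, (dist (Site.toComplex (xr s)) z ≤ r + 4 ∧ R - 4 ≤ dist (Site.toComplex (yr s)) z) ∨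
        (dist (Site.toComplex (yr s)) z ≤ r + 4 ∧ R - 4 ≤ dist (Site.toComplex (xr s)) z)) := by
  classical
  set q : Fin k → Site 2 × Fin 4 := fun a => cornerOrbit (β a) (c a) (i a) with hq
  set n : Fin k → ℕ := fun a => j a - i a with hn
  have horb : ∀ a t, cornerOrbit (β a) (q a) t = cornerOrbit (β a) (c a) (i a + t) := fun a t =>
    (cornerOrbit_add_eq (β a) (c a) (i a) t).symm
  have hdir' : ∀ a, (dist (Site.toComplex (cornerOrbit (β a) (q a) 0).1) z ≤ r ∧
        R ≤ dist (Site.toComplex (cornerOrbit (β a) (q a) (n a)).1) z) ∨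
      (R ≤ dist (Site.toComplex (cornerOrbit (β a) (q a) 0).1) z ∧
        dist (Site.toComplex (cornerOrbit (β a) (q a) (n a)).1) z ≤ r) := by
    intro a
    rw [horb, horb, add_zero, show i a + n a = j a from Nat.add_sub_cancel' (hij a)]
    exact hdir a
  choose E F T m i' j' hEd hFd htight hTsub hmT hmstrict hi'm hmj' hj'n hchain hends using
    fun a => strand_tightArc (β a) (q a) (n a) z hrR (hdir' a)
  set K : Set ℂ := ⋃ a, ⋃ jj ∈ Finset.range (2 * n a + 1),
    segment ℝ (pieceVert (β a) (q a) jj) (pieceVert (β a) (q a) (jj + 1)) with hK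
  have hKc : IsClosed K := by
    refine isClosed_iUnion_of_finite fun a => isClosed_biUnion_finset fun jj _ => ?_
    rw [← Path.range_segment]
    exact (isCompact_range (Path.segment _ _).continuous).isClosed
  have hmemK : ∀ {w : ℂ}, w ∈ K ↔ ∃ a jj, jj ≤ 2 * n a ∧ w ∈ segment ℝ (pieceVert (β a) (q a) jj) (pieceVert (β a) (q a) (jj + 1)) := by
    intro w
    simp only [hK, mem_iUnion, Finset.mem_range, exists_prop]
    constructor
    · rintro ⟨a, jj, hjj, hw⟩; exact ⟨a, jj, by omega, hw⟩
    · rintro ⟨a, jj, hjj, hw⟩; exact ⟨a, jj, by omega, hw⟩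
  have hpieceK : ∀ a jj, jj ≤ 2 * n a → segment ℝ (pieceVert (β a) (q a) jj) (pieceVert (β a) (q a) (jj + 1)) ⊆ K :=
    fun a jj hjj w hw => hmemK.2 ⟨a, jj, hjj, hw⟩
  have hTK : ∀ a, range (T a) ⊆ K := by
    intro a w hw
    obtain ⟨jj, hjj, hw⟩ := mem_iUnion₂.1 (hTsub a hw)
    exact hpieceK a jj (by have := Finset.mem_range.1 hjj; omega) hw
  have hvert : ∀ u : Site 2, Site.toComplex u ∉ K := fun u hu => by
    obtain ⟨a, jj, -, hw⟩ := hmemK.1 hu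
    exact toComplex_not_mem_piece (β a) (q a) u jj hw
  have hcent : ∀ g : Site 2, faceCenter g ∉ K := fun g hg => by
    obtain ⟨a, jj, -, hw⟩ := hmemK.1 hg
    exact faceCenter_not_mem_piece (β a) (q a) g jj hw
  have hdisq : ∀ a b, a ≠ b → ∀ s u, s ≤ n a → u ≤ n b → cornerOrbit (β a) (q a) s ≠ cornerOrbit (β b) (q b) u := by
    intro a b hab s u hs hu
    rw [horb, horb]
    have h1 := hij a; have h2 := hij b
    exact hdis a b hab (i a + s) (i b + u) (Nat.le_add_right _ _) (by simp only [hn] at hs; omega)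
      (Nat.le_add_right _ _) (by simp only [hn] at hu; omega)
  have hKe : ∀ a u, u + 1 ≤ n a → cTgt (cornerOrbit (β a) (q a) u) ∈ β a →
      ∀ P ∈ segment ℝ (Site.toComplex (cornerOrbit (β a) (q a) u).1)
        (Site.toComplex ((cornerOrbit (β a) (q a) u).1 + cornerUnit ((cornerOrbit (β a) (q a) u).2 + 1))), P ∉ K := by
    intro a u hu hopen P hP hPK
    obtain ⟨b, jj, hjj, hPb⟩ := hmemK.1 hPK
    by_cases hab : b = a
    · subst hab
      exact openEdge_not_mem_piece (q b) ((SimpleGraph.mem_edgeSet _).1 (cTgt_mem_edgeSet _)) hopen hPb hP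
    · exact followedEdge_not_mem_pieces_HT4' (q a) (q b) hopen
        (fun s' u' hs' h2 => hdisq a b (Ne.symm hab) s' u' (by rcases hs' with rfl | rfl <;> omega) h2) hjj hPb hP
  have hKx : ∀ a u, u + 1 ≤ n a → cTgt (cornerOrbit (β a) (q a) u) ∉ β a →
      ∀ P ∈ segment ℝ (faceCenter (cFace (cornerOrbit (β a) (q a) u)))
        (faceCenter (faceAt (cornerOrbit (β a) (q a) u).1 ((cornerOrbit (β a) (q a) u).2 + 1))), P ∉ K := by
    intro a u hu hclosed P hP hPK
    obtain ⟨b, jj, hjj, hPb⟩ := hmemK.1 hPK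
    by_cases hab : b = a
    · subst hab
      exact crossSeg_not_mem_piece (q b) hclosed hPb hP
    · exact crossSeg_not_mem_pieces_HT4' (q a) (q b) hclosed
        (fun s' u' hs' h2 => hdisq a b (Ne.symm hab) s' u' (by rcases hs' with rfl | rfl <;> omega) h2) hjj hPb hP
  have hZK' : ∀ w ∈ Z, w ∉ K := by
    intro w hwZ hwK
    obtain ⟨a, jj, hjj, hw⟩ := hmemK.1 hwK
    obtain ⟨t', rfl | rfl⟩ := Nat.even_or_odd' jj
    · rw [pieceVert_even, pieceVert_odd, horb] at hw
      have hia := hij a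
      exact (hZK a (i a + t') (Nat.le_add_right _ _) (by simp only [hn] at hjj; omega)).1 w hw hwZ
    · rw [show 2 * t' + 1 + 1 = 2 * t' + 2 by ring, pieceVert_odd, pieceVert_odd_succ] at hw
      have h2 : sPt (nextCorner (β a) (cornerOrbit (β a) (q a) t')) = sPt (cornerOrbit (β a) (c a) (i a + t' + 1)) := by
        rw [show i a + t' + 1 = i a + (t' + 1) by ring, ← horb]; rfl
      rw [h2, horb] at hw
      have hia := hij a
      exact (hZK a (i a + t') (Nat.le_add_right _ _) (by simp only [hn] at hjj; omega)).2
        (by simp only [hn] at hjj; omega) w hw hwZ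
  have hdisj : ∀ a b, a ≠ b → Disjoint (range (T a)) (range (T b)) := by
    intro a b hab
    refine Set.disjoint_left.2 fun w hw hw' => ?_
    obtain ⟨jj, hjj, hw⟩ := mem_iUnion₂.1 (hTsub a hw)
    obtain ⟨jj', hjj', hw'⟩ := mem_iUnion₂.1 (hTsub b hw')
    have hjj₁ := Finset.mem_range.1 hjj
    have hjj₂ := Finset.mem_range.1 hjj'
    obtain ⟨s, t, hs, ht, hst⟩ := pieces_meet_two_HT4 (q a) (q b) hw hw'
    exact hdisq a b hab s t (by omega) (by omega) hst
  set U : Set ℂ := {w | r + 1 / 2 < dist w z ∧ dist w z < R - 1 / 2} with hU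
  set X : Set ℂ := U \ K with hX
  set cL : Fin k → Set ℂ := fun a => connectedComponentIn X (Site.toComplex (cornerOrbit (β a) (q a) (m a)).1) with hcL
  set cR : Fin k → Set ℂ := fun a => connectedComponentIn X (faceCenter (cFace (cornerOrbit (β a) (q a) (m a)))) with hcR
  have hcc : ∀ a t, i' a ≤ t → t ≤ j' a →
      Site.toComplex (cornerOrbit (β a) (q a) t).1 ∈ cL a ∧ faceCenter (cFace (cornerOrbit (β a) (q a) t)) ∈ cR a :=
    fun a t h1 h2 => chain_in_component_steps_HT4 (β a) (q a) z K hvert hcent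
      (fun u _ hu => hKe a u (by have := hj'n a; omega)) (fun u _ hu => hKx a u (by have := hj'n a; omega))
      (hchain a) (hi'm a) (hmj' a) h1 h2
  have hprobe : ∀ a, segment ℝ (Site.toComplex (cornerOrbit (β a) (q a) (m a)).1) (faceCenter (cFace (cornerOrbit (β a) (q a) (m a)))) ⊆ U ∧
      (segment ℝ (Site.toComplex (cornerOrbit (β a) (q a) (m a)).1) (faceCenter (cFace (cornerOrbit (β a) (q a) (m a)))) ∩ K).Nonempty ∧
      segment ℝ (Site.toComplex (cornerOrbit (β a) (q a) (m a)).1) (faceCenter (cFace (cornerOrbit (β a) (q a) (m a)))) ∩ K ⊆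
        segment ℝ (sPt (cornerOrbit (β a) (q a) (m a))) (tPt (cornerOrbit (β a) (q a) (m a))) := by
    intro a
    have hc := hchain a (m a) (hi'm a) (hmj' a)
    refine ⟨fun P hP => ?_, ?_, ?_⟩
    · obtain ⟨h1, h2⟩ := segment_annulus ⟨hc.1, hc.2.1⟩ ⟨hc.2.2.1, hc.2.2.2⟩
        (by rw [dist_comm]; exact (dist_faceCenter_vertex_lt _).le.trans (by norm_num)) P hP
      exact ⟨by linarith, by linarith⟩
    · obtain ⟨P, hP, hPo⟩ := exists_mem_dartSeg_mem_openSegment (isCorner_cFace (cornerOrbit (β a) (q a) (m a)))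
      refine ⟨P, openSegment_subset_segment ℝ _ _ hPo, hpieceK a (2 * m a) (by have := hmj' a; have := hj'n a; omega) ?_⟩
      rw [piece_even_eq_cyDart, cyDart_eq]; exact hP
    · rintro w ⟨hw, hwK⟩
      obtain ⟨b, jj, -, hwb⟩ := hmemK.1 hwK
      obtain ⟨s, rfl, hs⟩ := eq_of_mem_piece_halfDiag (β b) (q b) (v := (cornerOrbit (β a) (q a) (m a)).1)
        (k := (cornerOrbit (β a) (q a) (m a)).2) hwb hw
      rw [pieceVert_even, pieceVert_odd, hs] at hwb
      exact hwb
  have htouch : ∀ a, (closure (cL a) ∩ range (T a) ∩ U).Nonempty ∧ (closure (cR a) ∩ range (T a) ∩ U).Nonempty := by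
    intro a
    obtain ⟨hpU, hpne, hpD⟩ := hprobe a
    constructor
    · obtain ⟨P, hPD, hPcl⟩ := exists_mem_closure_of_probe hKc (hvert _) hpU hpne hpD
      exact ⟨P, ⟨hPcl, hmT a hPD⟩, hmstrict a P hPD⟩
    · rw [segment_symm] at hpU hpne hpD
      obtain ⟨P, hPD, hPcl⟩ := exists_mem_closure_of_probe hKc (hcent _) hpU hpne hpD
      exact ⟨P, ⟨hPcl, hmT a hPD⟩, hmstrict a P hPD⟩
  have hthree : ∀ (S : Set ℂ), S ⊆ X → IsPreconnected S → ∀ a₁ a₂ a₃ : Fin k, a₁ ≠ a₂ → a₂ ≠ a₃ → a₃ ≠ a₁ →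
      (closure S ∩ range (T a₁) ∩ U).Nonempty → (closure S ∩ range (T a₂) ∩ U).Nonempty →
      (closure S ∩ range (T a₃) ∩ U).Nonempty → False := by
    intro S hSX hS a₁ a₂ a₃ h12 h23 h31 ht1 ht2 ht3
    exact not_three_arcs_touch (by linarith) (by linarith) T hEd hFd
      (fun l u => ⟨(htight l _ ⟨u, rfl⟩).1, (htight l _ ⟨u, rfl⟩).2.1⟩)
      (fun l u hu => (htight l _ ⟨u, rfl⟩).2.2.1 hu) (fun l u hu => (htight l _ ⟨u, rfl⟩).2.2.2 hu) hdisj hS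
      (fun w hw => (hSX hw).1) (fun l => Set.disjoint_left.2 fun w hw hw' => (hSX hw).2 (hTK l hw')) h12 h23 h31
      ht1 ht2 ht3
  have hfibL : ∀ a₁ a₂ a₃ : Fin k, a₁ ≠ a₂ → a₂ ≠ a₃ → a₃ ≠ a₁ → cL a₁ = cL a₂ → cL a₂ = cL a₃ → False := by
    intro a₁ a₂ a₃ h12 h23 h31 e12 e23
    refine hthree (cL a₁) (connectedComponentIn_subset _ _) isPreconnected_connectedComponentIn a₁ a₂ a₃ h12 h23 h31
      (htouch a₁).1 ?_ ?_
    · rw [e12]; exact (htouch a₂).1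
    · rw [e12, e23]; exact (htouch a₃).1
  have hfibR : ∀ a₁ a₂ a₃ : Fin k, a₁ ≠ a₂ → a₂ ≠ a₃ → a₃ ≠ a₁ → cR a₁ = cR a₂ → cR a₂ = cR a₃ → False := by
    intro a₁ a₂ a₃ h12 h23 h31 e12 e23
    refine hthree (cR a₁) (connectedComponentIn_subset _ _) isPreconnected_connectedComponentIn a₁ a₂ a₃ h12 h23 h31
      (htouch a₁).2 ?_ ?_
    · rw [e12]; exact (htouch a₂).2
    · rw [e12, e23]; exact (htouch a₃).2
  have hZX : Z ⊆ X := fun w hw => ⟨hZU w hw, hZK' w hw⟩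
  have hZone : ∀ (C₁ C₂ : Set ℂ) (b₁ b₂ : ℂ), C₁ = connectedComponentIn X b₁ → C₂ = connectedComponentIn X b₂ →
      (C₁ ∩ Z).Nonempty → (C₂ ∩ Z).Nonempty → C₁ = C₂ := by
    rintro C₁ C₂ b₁ b₂ rfl rfl ⟨P₁, hP₁C, hP₁Z⟩ ⟨P₂, hP₂C, hP₂Z⟩
    have hZsub : Z ⊆ connectedComponentIn X P₁ := hZc.subset_connectedComponentIn hP₁Z hZX
    rw [connectedComponentIn_eq hP₁C, connectedComponentIn_eq hP₂C]
    exact connectedComponentIn_eq (hZsub hP₂Z)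
  choose WL hWLs hWLe using fun s => exists_leftWalk (β s) (q s) (i' s) (j' s) ((hi'm s).trans (hmj' s))
  choose WR hWRs hWRd using fun s => exists_rightWalk (β s) (q s) (i' s) (j' s) ((hi'm s).trans (hmj' s))
  have hface1 : ∀ (g : Site 2) (d : ℝ), dist (faceCenter g) z < d → dist (Site.toComplex g) z ≤ d + 1 := by
    intro g d h
    have hx := dist_toComplex_faceCenter_lt g
    linarith [dist_triangle (Site.toComplex g) (faceCenter g) z]
  have hface2 : ∀ (g : Site 2) (d : ℝ), d < dist (faceCenter g) z → d - 1 ≤ dist (Site.toComplex g) z := by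
    intro g d h
    have hx := dist_toComplex_faceCenter_lt g
    linarith [dist_triangle (faceCenter g) (Site.toComplex g) z, dist_comm (faceCenter g) (Site.toComplex g)]
  have hrange : ∀ s t, i' s ≤ t → t ≤ j' s → i s ≤ i s + t ∧ i s + t ≤ j s := fun s t _ h2 =>
    ⟨Nat.le_add_right _ _, by have h3 := hj'n s; have h4 := hij s; simp only [hn] at h3; omega⟩
  refine ⟨cL, cR, _, _, _, _, WL, WR,
    fun s₁ s₂ P h1 h2 => (connectedComponentIn_eq h1).trans (connectedComponentIn_eq h2).symm,
    fun s₁ s₂ P h1 h2 => (connectedComponentIn_eq h1).trans (connectedComponentIn_eq h2).symm,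
    hfibL, hfibR, fun s₁ s₂ h1 h2 => hZone _ _ _ _ rfl rfl h1 h2, fun s₁ s₂ h1 h2 => hZone _ _ _ _ rfl rfl h1 h2,
    fun s w hw => ?_, fun s u hu => ?_, fun s e he => ?_, fun s => ?_, fun s g hg => ?_, fun s d hd => ?_, fun s => ?_⟩
  · rcases hw with hw | hw
    · exact (connectedComponentIn_subset _ _ hw).1
    · exact (connectedComponentIn_subset _ _ hw).1
  · obtain ⟨t, h1, h2, rfl⟩ := hWLs s u hu
    have hc := hchain s t h1 h2
    refine ⟨(hcc s t h1 h2).1, i s + t, (hrange s t h1 h2).1, (hrange s t h1 h2).2, by rw [horb], hc.1, hc.2.1⟩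
  · obtain ⟨t, h1, h2, rfl, hopen⟩ := hWLe s e he
    have hc := hchain s t h1 h2.le
    refine ⟨i s + t, Nat.le_add_right _ _, ?_, by rw [horb], by rw [← horb]; exact hopen,
      by rw [← horb]; exact hc.1, by rw [← horb]; exact hc.2.1⟩
    have h3 := hj'n s; have h4 := hij s; simp only [hn] at h3; omega
  · rcases hends s with ⟨h1, -, h3, -⟩ | ⟨h1, -, h3, -⟩
    · exact Or.inl ⟨by linarith, by linarith⟩
    · exact Or.inr ⟨by linarith, by linarith⟩
  · obtain ⟨t, h1, h2, rfl⟩ := hWRs s g hg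
    have hc := hchain s t h1 h2
    refine ⟨(hcc s t h1 h2).2, i s + t, (hrange s t h1 h2).1, (hrange s t h1 h2).2, by rw [horb], hc.2.2.1, hc.2.2.2⟩
  · obtain ⟨t, h1, h2, hsep, hclosed⟩ := hWRd s d hd
    have hc := hchain s t h1 h2.le
    refine ⟨i s + t, Nat.le_add_right _ _, ?_, by rw [hsep, horb], by rw [← horb]; exact hclosed,
      by rw [← horb]; exact hc.1, by rw [← horb]; exact hc.2.1⟩
    have h3 := hj'n s; have h4 := hij s; simp only [hn] at h3; omega
  · rcases hends s with ⟨-, h2, -, h4⟩ | ⟨-, h2, -, h4⟩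
    · exact Or.inl ⟨by linarith [hface1 _ _ h2], by linarith [hface2 _ _ h4]⟩
    · exact Or.inr ⟨by linarith [hface1 _ _ h4], by linarith [hface2 _ _ h2]⟩

/-- **Sectors relative to an exterior set, several configurations** (registered anchor
`ufrs_strandsSectorsZ_mixed` of stmt-CriticalPhenomena-11387; `strands_sectorsZ_mixed_HT4` verbatim). -/
theorem ufrs_strandsSectorsZ_mixed : ∀ (k : ℕ) (β : Fin k → BondConfig (Site 2)) (z : ℂ) (c : Fin k → Site 2 × Fin 4) (i j : Fin k → ℕ) (r R : ℝ), 0 ≤ r → r + 16 ≤ R → (∀ a, i a ≤ j a) → (∀ a, (dist (Site.toComplex (cornerOrbit (β a) (c a) (i a)).1) z ≤ r ∧ R ≤ dist (Site.toComplex (cornerOrbit (β a) (c a) (j a)).1) z) ∨ (R ≤ dist (Site.toComplex (cornerOrbit (β a) (c a) (i a)).1) z ∧ dist (Site.toComplex (cornerOrbit (β a) (c a) (j a)).1) z ≤ r)) → (∀ a b, a ≠ b → ∀ s t, i a ≤ s → s ≤ j a → i b ≤ t → t ≤ j b → cornerOrbit (β a) (c a) s ≠ cornerOrbit (β b) (c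 b) t) → ∀ (Z : Set ℂ), (∀ w ∈ Z, r + 1 / 2 < dist w z ∧ dist w z < R - 1 / 2) → IsPreconnected Z → (∀ a t, i a ≤ t → t ≤ j a → (∀ w ∈ segment ℝ (sPt (cornerOrbit (β a) (c a) t)) (tPt (cornerOrbit (β a) (c a) t)), w ∉ Z) ∧ (t < j a → ∀ w ∈ segment ℝ (tPt (cornerOrbit (β a) (c a) t)) (sPt (cornerOrbit (β a) (c a) (t + 1))), w ∉ Z)) → ∃ (cL cR : Fin k → Set ℂ) (xl yl xr yr : Fin k → Site 2) (WL : ∀ s, (zdGraph 2).Walk (xl s) (yl s)) (WR : ∀ s, (zdGraph 2).Walk (xr s) (yr s)), (∀ s₁ s₂ (P : ℂ), P ∈ cL s₁ → P ∈ cL s₂ → cL s₁ = cL s₂) ∧ (∀ s₁ s₂ (P : ℂ), P ∈ cR s₁ → P ∈ cR s₂ → cR s₁ = cR s₂) ∧ (∀ a₁ a₂ a₃ : Fin k, a₁ ≠ a₂ → a₂ ≠ a₃ → a₃ ≠ a₁ → cL a₁ = cL a₂ → cL a₂ = cL a₃ → False) ∧ (∀ a₁ a₂ a₃ : Fin k,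 a₁ ≠ a₂ → a₂ ≠ a₃ → a₃ ≠ a₁ → cR a₁ = cR a₂ → cR a₂ = cR a₃ → False) ∧ (∀ s₁ s₂, (cL s₁ ∩ Z).Nonempty → (cL s₂ ∩ Z).Nonempty → cL s₁ = cL s₂) ∧ (∀ s₁ s₂, (cR s₁ ∩ Z).Nonempty → (cR s₂ ∩ Z).Nonempty → cR s₁ = cR s₂) ∧ (∀ s, ∀ w ∈ cL s ∪ cR s, r + 1 / 2 < dist w z ∧ dist w z < R - 1 / 2) ∧ (∀ s, ∀ u ∈ (WL s).support, Site.toComplex u ∈ cL s ∧ ∃ t, i s ≤ t ∧ t ≤ j s ∧ u = (cornerOrbit (β s) (c s) t).1 ∧ r + 1 < dist (Site.toComplex u) z ∧ dist (Site.toComplex u) z < R - 1) ∧ (∀ s, ∀ e ∈ (WL s).edges, ∃ t, i s ≤ t ∧ t < j s ∧ e = cTgt (cornerOrbit (β s) (c s) t) ∧ cTgt (cornerOrbit (β s) (c s) t) ∈ β s ∧ r + 1 < dist (Site.toComplex (cornerOrbit (β s) (c s) t).1) z ∧ dist (Site.toComplex (cornerOrbit (β s) (c s) t).1) z < R - 1)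 ∧ (∀ s, (dist (Site.toComplex (xl s)) z ≤ r + 4 ∧ R - 4 ≤ dist (Site.toComplex (yl s)) z) ∨ (dist (Site.toComplex (yl s)) z ≤ r + 4 ∧ R - 4 ≤ dist (Site.toComplex (xl s)) z)) ∧ (∀ s, ∀ g ∈ (WR s).support, faceCenter g ∈ cR s ∧ ∃ t, i s ≤ t ∧ t ≤ j s ∧ g = cFace (cornerOrbit (β s) (c s) t) ∧ r + 1 < dist (faceCenter g) z ∧ dist (faceCenter g) z < R - 1) ∧ (∀ s, ∀ d ∈ (WR s).darts, ∃ t, i s ≤ t ∧ t < j s ∧ sepEdge d.fst d.snd = cTgt (cornerOrbit (β s) (c s) t) ∧ cTgt (cornerOrbit (β s) (c s) t) ∉ β s ∧ r + 1 < dist (Site.toComplex (cornerOrbit (β s) (c s) t).1) z ∧ dist (Site.toComplex (cornerOrbit (β s) (c s) t).1) z < R - 1) ∧ (∀ s, (dist (Site.toComplex (xr s)) z ≤ r + 4 ∧ R - 4 ≤ dist (Site.toComplex (yr s)) z) ∨ (dist (Site.toComplex (yr s)) z ≤ r + 4 ∧ R - 4 ≤ dist (Site.toComplex (xr s)) z))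 :=
  fun _k β z c i j _r _R hr hrR hij hdir hdis Z hZU hZc hZK => strands_sectorsZ_mixed_HT4 β z c i j hr hrR hij hdir hdis Z hZU hZc hZK

end

end Summit.CriticalPhenomena.CardyFormulaZ2.Cruxes.EdgePrecompact.QkzStripBoundaryArm
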